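import Literature.Analysis.FluidPDE.VorticityDoubleConeRegularity
import Literature.Analysis.FluidPDE.SelfSimilar
import HarnessLib

/-!
# Lei–Ren–Tian's double-cone criterion on backward (rotated) discretely self-similar fields

Topic `Analysis/FluidPDE`. This file adds NO new named fact: it proves consequences of the
vendored fact `LeiRenTian2025_doubleCone_regularity` (Lei–Ren–Tian 2025, Thm. 1.1, arXiv:2501.08976;
`VorticityDoubleConeRegularity.lean`) for velocity fields that are **rotated discretely
self-similar** on negative times (`IsRotatedDSS c R u`: `c Rᵀ u(c²t, cRx) = u(t,x)`, factor `c > 1`,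
`R` any linear isometry; `SelfSimilar.lean`), the objects of the backward (blow-up profile)
literature (Chae–Wolf 2017; Bradshaw–Tsai 2017, §5; Pineau–Vicol 2026).

## Results

* `IsRotatedDSS.eq_zero_of_norm_le_parabolicCylinder` — **a rotated-DSS field bounded on one
  backward parabolic cylinder `Q(ρ) = (-ρ², 0) × B_ρ(0)` at the space–time origin vanishes on all
  of `t < 0`** (pure scaling: the bound `B` on `Q(ρ)` propagates to `B/cᵏ` on `Q(cᵏρ)`, and
  `Q(cᵏρ) ↑ (-∞,0) × ℝ³`). This is Chae–Wolf 2017, §3, step 1 ("Condition for non trivial DSS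
  functions", arXiv:1610.09464 p. 8), printed for `R = 1` — with `R = 1` it is
  `IsDiscretelySelfSimilar.eq_zero_of_norm_le_parabolicCylinder`; the rotation does not enter the
  norm bound.
* (private) `norm_le_of_not_isBackwardSingularPoint` — for a field continuous on `{t < 0}`,
  "the origin is not a backward singular point" (`¬ IsBackwardSingularPoint u 0`: `u` essentially
  bounded on some `Q(ρ)`, Albritton–Barker / Lei–Ren–Tian footnote 1) upgrades to a pointwise
  bound on that `Q(ρ)` (an open set on which a continuous function exceeds its essential supremum
  has positive Lebesgue measure).
* `LeiRenTian2025_doubleCone_regularity.rdss_eq_zero` — **corollary of Thm. 1.1 for rotated-DSS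
  fields**: if `(u, p)` is rotated DSS with `c > 1`, a local suitable weak solution in `Q(1)`
  (`IsSuitableWeakSolutionInBall 1 0 u p`), continuous and slice-differentiable on `{t < 0}`
  (so the representative convention `LeiRenTian2025.IsClassicalAtRegularPoints` holds), and its
  vorticity satisfies the double-cone alternative of Thm. 1.1 on `Q(1)` (some unit `e`, `δ > 0`,
  `M > 0`: `|ω| ≤ M` or `|ξ × e| ≤ 1 - δ` at regular points), then `u ≡ 0` on `t < 0`. The
  `M`-free form `…rdss_eq_zero_of_cone` takes the cone condition wherever `ω ≠ 0` on `t < 0`.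

So, granted Thm. 1.1, the vorticity directions of a non-trivial backward rotated-DSS profile in
this class cannot be confined to a double cone about any axis (Lei–Ren–Tian's Cor. 1.5 read on a
self-similar object: the threshold `M` is immaterial because every non-zero vorticity direction of
the profile recurs along the scaling copies at unbounded magnitude).

## Deliberately not here

No statement about the similarity-variable profile `U(s,y) = √(-t) u(t,x)` or its direction set
(the corollary is stated on the physical field, exactly in the fact's vocabulary); no claim that a
given ancient / Type-I class satisfies `IsSuitableWeakSolutionInBall 1 0` (that needs space–time
decay of `∇u` and `p`, not only of `u`); nothing numeric.

## References

* Z. Lei, X. Ren, G. Tian, *A geometric characterization of potential Navier–Stokes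
  singularities*, arXiv:2501.08976 (2025), Thm. 1.1, Cor. 1.5. [LeiRenTian2025]
* D. Chae, J. Wolf, *Removing discretely self-similar singularities for the 3D Navier–Stokes
  equations*, Comm. PDE 42 (2017), §3 step 1 (and (3.6): space–time decay of all derivatives of a
  Type-I DSS solution). [ChaeWolf2017RemovingDSS]
* Z. Bradshaw, T.-P. Tsai, *Rotationally corrected scaling invariant solutions to the
  Navier–Stokes equations*, Comm. PDE 42 (2017), §1 (v-RDSS) and §5. [BradshawTsai2017CPDE]
-/

noncomputable section

open MeasureTheory Set Function Filter Metric
open scoped ENNReal NNReal Topology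

namespace Literature.Analysis.FluidPDE

/-! ### Scaling: a rotated-DSS field bounded near the origin vanishes -/

section Scaling

variable {E : Type*} [NormedAddCommGroup E] [NormedSpace ℝ E]

omit [NormedSpace ℝ E] in
/-- Membership in the backward parabolic cylinder at the space–time origin:
`(t, x) ∈ Q(r) ↔ -r² < t < 0 ∧ ‖x‖ < r` (private helper). [folklore] -/
private theorem mem_parabolicCylinder_zero {r t : ℝ} {x : E} :
    ((t, x) : ℝ × E) ∈ parabolicCylinder r (0 : ℝ × E) ↔ (-r ^ 2 < t ∧ t < 0) ∧ ‖x‖ < r := by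
  simp [mem_parabolicCylinder, dist_zero_right]

/-- **Inverse form of rotated discrete self-similarity.** If `c Rᵀ u(c²t, cRx) = u(t,x)` for all
`(t, x)` and `c ≠ 0`, then `‖u(t, x)‖ = c⁻¹ ‖u(t/c², c⁻¹ R⁻¹ x)‖`: the value at a point is `c⁻¹`
times the value at its contracted preimage (private helper). [folklore] -/
private theorem IsRotatedDSS.norm_eq_inv_mul {c : ℝ} {R : E ≃ₗᵢ[ℝ] E} {u : ℝ → E → E}
    (h : IsRotatedDSS c R u) (hc : 0 < c) (t : ℝ) (x : E) :
    ‖u t x‖ = c⁻¹ * ‖u (t / c ^ 2) (c⁻¹ • R.symm x)‖ := by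
  have key := h (t / c ^ 2) (c⁻¹ • R.symm x)
  have hc0 : c ≠ 0 := hc.ne'
  have h1 : c ^ 2 * (t / c ^ 2) = t := by field_simp
  have h2 : c • R (c⁻¹ • R.symm x) = x := by
    rw [R.map_smul, R.apply_symm_apply, smul_smul, mul_inv_cancel₀ hc0, one_smul]
  rw [h1, h2] at key
  -- `key : c • R.symm (u t x) = u (t / c ^ 2) (c⁻¹ • R.symm x)`
  rw [← key, norm_smul, LinearIsometryEquiv.norm_map, Real.norm_of_nonneg hc.le, ← mul_assoc,
    inv_mul_cancel₀ hc0, one_mul]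

/-- **A rotated-DSS field bounded on a backward parabolic cylinder at the origin vanishes on
`t < 0`.** If `u` is rotated discretely self-similar with factor `c > 1` and rotation `R`
(`c Rᵀ u(c²t, cRx) = u(t,x)`), and `‖u‖ ≤ B` on `Q(ρ) = (-ρ², 0) × B_ρ(0)` for some `ρ > 0`, then
`u(t, x) = 0` for every `t < 0` and every `x`. Proof: by the inverse scaling relation the bound on
`Q(cᵏρ)` is `B/cᵏ`; every `(t, x)` with `t < 0` lies in `Q(cᵏρ)` for all large `k`, and
`B/cᵏ → 0`. This is Chae–Wolf 2017, §3, step 1 ("Condition for non trivial DSS functions": a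
`λ`-DSS solution bounded in `Q(0, 1/2)` satisfies `|u(x,t)| = λ⁻ᵏ|u(λ⁻ᵏx, λ⁻²ᵏt)| ≤ Cλ⁻ᵏ → 0`),
printed for `R = 1`; the rotation does not enter the norm bound, so the same line proves the
rotated case (Bradshaw–Tsai's v-RDSS class).
[cite: ChaeWolf2017RemovingDSS, §3 step 1 (arXiv:1610.09464 p. 8)] -/
theorem IsRotatedDSS.eq_zero_of_norm_le_parabolicCylinder {c : ℝ} (hc : 1 < c)
    {R : E ≃ₗᵢ[ℝ] E} {u : ℝ → E → E} (h : IsRotatedDSS c R u) {ρ B : ℝ} (hρ : 0 < ρ)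
    (hB : ∀ z ∈ parabolicCylinder ρ (0 : ℝ × E), ‖u z.1 z.2‖ ≤ B) :
    ∀ t < 0, ∀ x, u t x = 0 := by
  have hc0 : 0 < c := zero_lt_one.trans hc
  -- the bound propagates: `‖u‖ ≤ B / c^k` on `Q(c^k ρ)`
  have hprop : ∀ k : ℕ, ∀ t : ℝ, ∀ x : E,
      ((t, x) : ℝ × E) ∈ parabolicCylinder (c ^ k * ρ) (0 : ℝ × E) → ‖u t x‖ ≤ B / c ^ k := by
    intro k
    induction k with
    | zero =>
      intro t x hz
      simpa using hB (t, x) (by simpa using hz)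
    | succ k ih =>
      intro t x hz
      rw [mem_parabolicCylinder_zero] at hz
      obtain ⟨⟨ht1, ht2⟩, hx⟩ := hz
      have hck : 0 < c ^ k := pow_pos hc0 k
      -- the contracted preimage lies in `Q(c^k ρ)`
      have hz' : ((t / c ^ 2, c⁻¹ • R.symm x) : ℝ × E) ∈
          parabolicCylinder (c ^ k * ρ) (0 : ℝ × E) := by
        rw [mem_parabolicCylinder_zero]
        refine ⟨⟨?_, ?_⟩, ?_⟩
        · rw [lt_div_iff₀ (pow_pos hc0 2)]
          have : (c ^ (k + 1) * ρ) ^ 2 = (c ^ k * ρ) ^ 2 * c ^ 2 := by ring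
          linarith
        · exact div_neg_of_neg_of_pos ht2 (pow_pos hc0 2)
        · rw [norm_smul, LinearIsometryEquiv.norm_map, Real.norm_of_nonneg (inv_nonneg.2 hc0.le),
            inv_mul_lt_iff₀ hc0]
          calc ‖x‖ < c ^ (k + 1) * ρ := hx
            _ = c * (c ^ k * ρ) := by ring
      calc ‖u t x‖ = c⁻¹ * ‖u (t / c ^ 2) (c⁻¹ • R.symm x)‖ := h.norm_eq_inv_mul hc0 t x
        _ ≤ c⁻¹ * (B / c ^ k) :=
          mul_le_mul_of_nonneg_left (ih _ _ hz') (inv_nonneg.2 hc0.le)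
        _ = B / c ^ (k + 1) := by rw [pow_succ]; field_simp
  intro t ht x
  -- `(t, x) ∈ Q(c^k ρ)` eventually, and `B / c^k → 0`
  have hgrow : Tendsto (fun k : ℕ => c ^ k * ρ) atTop atTop :=
    (tendsto_pow_atTop_atTop_of_one_lt hc).atTop_mul_const hρ
  have hev : ∀ᶠ k : ℕ in atTop, ‖u t x‖ ≤ B / c ^ k := by
    filter_upwards [hgrow.eventually_gt_atTop ‖x‖, hgrow.eventually_gt_atTop (Real.sqrt (-t))]
      with k hkx hkt
    refine hprop k t x (mem_parabolicCylinder_zero.2 ⟨⟨?_, ht⟩, hkx⟩)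
    have hs : 0 ≤ Real.sqrt (-t) := Real.sqrt_nonneg _
    have h1 : Real.sqrt (-t) ^ 2 < (c ^ k * ρ) ^ 2 := by gcongr
    rw [Real.sq_sqrt (by linarith)] at h1
    linarith
  have hlim : Tendsto (fun k : ℕ => B / c ^ k) atTop (𝓝 0) :=
    tendsto_const_nhds.div_atTop (tendsto_pow_atTop_atTop_of_one_lt hc)
  have h0 : ‖u t x‖ ≤ 0 := ge_of_tendsto hlim hev
  exact norm_le_zero_iff.1 h0

/-- The same for plain discrete self-similarity (`R = 1`): a `λ`-DSS field (`λ > 1`) bounded on a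
backward parabolic cylinder at the origin vanishes on `t < 0` — Chae–Wolf 2017, §3, step 1, as
printed (`R = 1`). [cite: ChaeWolf2017RemovingDSS, §3 step 1 (arXiv:1610.09464 p. 8)] -/
theorem IsDiscretelySelfSimilar.eq_zero_of_norm_le_parabolicCylinder {c : ℝ} (hc : 1 < c)
    {u : ℝ → E → E} (h : IsDiscretelySelfSimilar c u) {ρ B : ℝ} (hρ : 0 < ρ)
    (hB : ∀ z ∈ parabolicCylinder ρ (0 : ℝ × E), ‖u z.1 z.2‖ ≤ B) :
    ∀ t < 0, ∀ x, u t x = 0 :=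
  (isRotatedDSS_refl_iff.2 h).eq_zero_of_norm_le_parabolicCylinder hc hρ hB

end Scaling

/-! ### From essential to pointwise boundedness for continuous fields -/

/-- For a field `u` continuous on `{t < 0}`, if the space–time origin is **not** a backward singular
point (`u` essentially bounded on some `Q(ρ)`, `ρ > 0` — Lei–Ren–Tian's "regular point",
footnote 1; Albritton–Barker 2019), then `u` is pointwise bounded on that `Q(ρ)`: the set where a
continuous function exceeds its essential supremum on an open set is open, hence null only if
empty. (Private helper.) [folklore] -/
private theorem norm_le_of_not_isBackwardSingularPoint
    {u : ℝ → (EuclideanSpace ℝ (Fin 3)) → (EuclideanSpace ℝ (Fin 3))}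
    (hcont : ContinuousOn (uncurry u) {z : ℝ × (EuclideanSpace ℝ (Fin 3)) | z.1 < 0})
    (h : ¬ IsBackwardSingularPoint u 0) :
    ∃ ρ : ℝ, 0 < ρ ∧ ∃ B : ℝ,
      ∀ z ∈ parabolicCylinder ρ (0 : ℝ × (EuclideanSpace ℝ (Fin 3))), ‖u z.1 z.2‖ ≤ B := by
  obtain ⟨ρ, hρ, hfin⟩ := not_isBackwardSingularPoint_iff.1 h
  set Q : Set (ℝ × (EuclideanSpace ℝ (Fin 3))) :=
    parabolicCylinder ρ (0 : ℝ × (EuclideanSpace ℝ (Fin 3))) with hQ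
  set S : ℝ≥0∞ := eLpNorm (uncurry u) ∞ (volume.restrict Q) with hS
  have hSne : S ≠ ∞ := hfin.ne
  have hQopen : IsOpen Q := isOpen_parabolicCylinder ρ 0
  have hQsub : Q ⊆ {z : ℝ × (EuclideanSpace ℝ (Fin 3)) | z.1 < 0} := by
    rintro ⟨t, x⟩ hz
    exact ((mem_parabolicCylinder_zero.1 hz).1).2
  -- a.e. bound on `Q`
  have hae : ∀ᵐ z ∂(volume.restrict Q), ‖uncurry u z‖ₑ ≤ S := by
    rw [hS, eLpNorm_exponent_top]
    exact ae_le_eLpNormEssSup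
  -- the exceptional set is open, hence empty
  have hcontQ : ContinuousOn (fun z => ‖uncurry u z‖ₑ) Q :=
    (continuous_enorm.comp_continuousOn (hcont.mono hQsub))
  have hopen : IsOpen (Q ∩ (fun z => ‖uncurry u z‖ₑ) ⁻¹' Ioi S) :=
    hcontQ.isOpen_inter_preimage hQopen isOpen_Ioi
  have hnull : volume (Q ∩ (fun z => ‖uncurry u z‖ₑ) ⁻¹' Ioi S) = 0 := by
    have h1 : volume.restrict Q {z | ¬ ‖uncurry u z‖ₑ ≤ S} = 0 := ae_iff.1 hae
    rw [Measure.restrict_apply' hQopen.measurableSet] at h1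
    rw [← h1]
    congr 1
    ext z
    simp only [mem_inter_iff, mem_preimage, mem_Ioi, mem_setOf_eq, not_le]
    exact and_comm
  have hempty : Q ∩ (fun z => ‖uncurry u z‖ₑ) ⁻¹' Ioi S = ∅ :=
    (hopen.measure_eq_zero_iff volume).1 hnull
  refine ⟨ρ, hρ, S.toReal, fun z hz => ?_⟩
  have hzle : ‖uncurry u z‖ₑ ≤ S := by
    by_contra hlt
    have : z ∈ Q ∩ (fun z => ‖uncurry u z‖ₑ) ⁻¹' Ioi S := ⟨hz, not_le.1 hlt⟩
    rw [hempty] at this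
    exact this
  have : ENNReal.ofReal ‖u z.1 z.2‖ ≤ S := by
    rw [ofReal_norm]
    exact hzle
  exact (ENNReal.ofReal_le_iff_le_toReal hSne).1 this

/-! ### Corollaries of Lei–Ren–Tian 2025, Theorem 1.1, for rotated-DSS fields -/

/-- The space–time origin lies in the closure of the backward cylinder `Q(1/2)` (private helper).
[folklore] -/
private theorem zero_mem_closure_parabolicCylinder_half :
    (0 : ℝ × (EuclideanSpace ℝ (Fin 3))) ∈
      closure (parabolicCylinder (1 / 2) (0 : ℝ × (EuclideanSpace ℝ (Fin 3)))) := by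
  rw [parabolicCylinder, closure_prod_eq]
  refine ⟨?_, subset_closure (mem_ball_self (by norm_num))⟩
  have h : closure (Ioo ((0 : ℝ × (EuclideanSpace ℝ (Fin 3))).1 - (1 / 2 : ℝ) ^ 2)
      (0 : ℝ × (EuclideanSpace ℝ (Fin 3))).1) = Icc (-(1 / 4 : ℝ)) 0 := by
    rw [closure_Ioo (by norm_num)]
    norm_num
  rw [h]
  exact ⟨by norm_num, le_rfl⟩

/-- A field continuous and slice-differentiable on `{t < 0}` satisfies Lei–Ren–Tian's
representative convention on `Q(1) ⊆ {t < 0}` (private helper). [folklore] -/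
private theorem LeiRenTian2025.isClassicalAtRegularPoints_of_continuousOn
    {u : ℝ → (EuclideanSpace ℝ (Fin 3)) → (EuclideanSpace ℝ (Fin 3))}
    (hcont : ContinuousOn (uncurry u) {z : ℝ × (EuclideanSpace ℝ (Fin 3)) | z.1 < 0})
    (hdiff : ∀ t < 0, Differentiable ℝ (u t)) :
    LeiRenTian2025.IsClassicalAtRegularPoints u
      (parabolicCylinder 1 (0 : ℝ × (EuclideanSpace ℝ (Fin 3)))) := by
  rintro ⟨t, x⟩ hz -
  have ht : t < 0 := ((mem_parabolicCylinder_zero.1 hz).1).2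
  refine ⟨hcont.continuousAt ((isOpen_lt continuous_fst continuous_const).mem_nhds ht), ?_⟩
  exact (hdiff t ht) x

/-- **Corollary of Lei–Ren–Tian 2025, Thm. 1.1, for backward rotated-DSS fields** (ours; the
fact is taken as the hypothesis `hLRT`). Let `u` be rotated discretely self-similar with factor
`c > 1` and rotation `R` (`c Rᵀ u(c²t, cRx) = u(t,x)`), continuous and slice-differentiable on
`{t < 0}`, and let `(u, p)` be a local suitable weak solution of the unforced Navier–Stokes
equations in `Q(1)` (`IsSuitableWeakSolutionInBall 1 0 u p`, the class of Thm. 1.1). If for some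
unit vector `e` and constants `δ > 0`, `M > 0` the vorticity `ω = curl u(t,·)` satisfies, at every
regular point of `Q(1)`, `|ω| ≤ M` or `|ξ × e| ≤ 1 - δ` (`ξ = ω/|ω|`), then `u ≡ 0` on `t < 0`:
Thm. 1.1 makes the origin a regular point, continuity makes `u` bounded on some `Q(ρ)`, and a
rotated-DSS field bounded near the origin vanishes
(`IsRotatedDSS.eq_zero_of_norm_le_parabolicCylinder`).
[cite: LeiRenTian2025, Thm. 1.1 (arXiv:2501.08976, p. 4) — corollary for rotated-DSS fields] -/
theorem LeiRenTian2025_doubleCone_regularity.rdss_eq_zero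
    (hLRT : LeiRenTian2025_doubleCone_regularity)
    {c : ℝ} (hc : 1 < c) {R : (EuclideanSpace ℝ (Fin 3)) ≃ₗᵢ[ℝ] (EuclideanSpace ℝ (Fin 3))}
    {u : ℝ → (EuclideanSpace ℝ (Fin 3)) → (EuclideanSpace ℝ (Fin 3))}
    {p : ℝ → (EuclideanSpace ℝ (Fin 3)) → ℝ}
    (hdss : IsRotatedDSS c R u) (hsw : IsSuitableWeakSolutionInBall 1 0 u p)
    (hcont : ContinuousOn (uncurry u) {z : ℝ × (EuclideanSpace ℝ (Fin 3)) | z.1 < 0})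
    (hdiff : ∀ t < 0, Differentiable ℝ (u t))
    {e : (EuclideanSpace ℝ (Fin 3))} (he : ‖e‖ = 1) {δ M : ℝ} (hδ : 0 < δ) (hM : 0 < M)
    (hcone : ∀ z ∈ parabolicCylinder 1 (0 : ℝ × (EuclideanSpace ℝ (Fin 3))),
      ¬ IsBackwardSingularPoint u z →
      ‖curl (u z.1) z.2‖ ≤ M ∨
        ‖cross (vorticityDirection (curl (u z.1)) z.2) e‖ ≤ 1 - δ) :
    ∀ t < 0, ∀ x, u t x = 0 := by
  have hreg : ¬ IsBackwardSingularPoint u 0 :=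
    hLRT u p e δ M hsw (LeiRenTian2025.isClassicalAtRegularPoints_of_continuousOn hcont hdiff)
      he hδ hM hcone 0 zero_mem_closure_parabolicCylinder_half
  obtain ⟨ρ, hρ, B, hB⟩ := norm_le_of_not_isBackwardSingularPoint hcont hreg
  exact hdss.eq_zero_of_norm_le_parabolicCylinder hc hρ hB

/-- **`M`-free form.** Under the same standing hypotheses (rotated DSS with `c > 1`, continuous
and slice-differentiable on `{t < 0}`, local suitable weak solution in `Q(1)`), if the vorticity
direction lies in a fixed double cone wherever the vorticity is non-zero on `t < 0` —
`ω(x,t) ≠ 0 ⇒ |ξ(x,t) × e| ≤ 1 - δ` for some unit `e` and `δ > 0` — then `u ≡ 0` on `t < 0`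
(take `M = 1` in `…rdss_eq_zero`). Contrapositive: granted Thm. 1.1, the vorticity directions of a
non-trivial backward rotated-DSS field of this class are confined to no double cone about any
axis.
[cite: LeiRenTian2025, Thm. 1.1 and Cor. 1.5 (arXiv:2501.08976, p. 4) — rotated-DSS corollary] -/
theorem LeiRenTian2025_doubleCone_regularity.rdss_eq_zero_of_cone
    (hLRT : LeiRenTian2025_doubleCone_regularity)
    {c : ℝ} (hc : 1 < c) {R : (EuclideanSpace ℝ (Fin 3)) ≃ₗᵢ[ℝ] (EuclideanSpace ℝ (Fin 3))}
    {u : ℝ → (EuclideanSpace ℝ (Fin 3)) → (EuclideanSpace ℝ (Fin 3))}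
    {p : ℝ → (EuclideanSpace ℝ (Fin 3)) → ℝ}
    (hdss : IsRotatedDSS c R u) (hsw : IsSuitableWeakSolutionInBall 1 0 u p)
    (hcont : ContinuousOn (uncurry u) {z : ℝ × (EuclideanSpace ℝ (Fin 3)) | z.1 < 0})
    (hdiff : ∀ t < 0, Differentiable ℝ (u t))
    {e : (EuclideanSpace ℝ (Fin 3))} (he : ‖e‖ = 1) {δ : ℝ} (hδ : 0 < δ)
    (hcone : ∀ t < 0, ∀ x, curl (u t) x ≠ 0 →
      ‖cross (vorticityDirection (curl (u t)) x) e‖ ≤ 1 - δ) :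
    ∀ t < 0, ∀ x, u t x = 0 := by
  refine hLRT.rdss_eq_zero hc hdss hsw hcont hdiff he hδ one_pos fun z hz _ => ?_
  have ht : z.1 < 0 := ((mem_parabolicCylinder (z := 0)).1 hz).1.2
  by_cases h0 : curl (u z.1) z.2 = 0
  · left
    rw [h0, norm_zero]
    exact zero_le_one
  · right
    exact hcone z.1 (by simpa using ht) z.2 h0

end Literature.Analysis.FluidPDE

end
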